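import Literature.Computability.AlgebraicComplexity.PolynomialKoszulYoungFlatteningDuality
import Literature.Computability.AlgebraicComplexity.DeterminantBorderWaringRank
import Literature.Barriers.ValiantsHypothesis.PartialDerivativesDetPerm
import Literature.Barriers.ValiantsHypothesis.ShiftedPartialsDegenerations
import HarnessLib
import HarnessLib.Audit

/-!
# `GCT/Max`: the leading-term family of `det_n` for the Koszul–Young flattening — PART 1: the family `𝒟(n,c,k)`,
# its derivative lists and wedge parts, and the nonzero value `ε·(± minor)` at the leading index

THIS MODULE is part 1 of 2 (size rule): definitions and the value at the leading index; PART 2 =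
`Summits/PneNP/GCT/Max/DetKYLeadingTerms.lean` (the count `|𝒟| = LT`, disjoint supports, colex triangularity, the bound
`max(LT, LT^dual) ≤ rank KY_{p,k}(det_n)`); the count function `LT` itself is `DetKYLeadingTerms.ltCount` in
`Summits/PneNP/GCT/Max/SF6Arithmetic.lean`. The mathematics of both parts is described here once.

Cell `pub-gct-max` (HOME `run/shared/lean/pub/pub-gct-max/`), track F, Lean port S-F-6 (lead D53/D65, referee read
2026-08-23T04:57:52Z "no objection", remarks R1–R4), typed/proved by lit-2; mathematics owner theory-2 (memo `CF3-THEOREM.md`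
§2, file of record `9ea98dd57dfc3673`). Module placed under `Summits/PneNP/GCT/Max/` by the inter-cell NAMING RULE
(pub-gct MODULE-MAP §6 l.100). Companion of the Literature modules `PolynomialKoszulYoungFlattening.lean` (`kyImage`,
`kyRankFin`, `kyRank`), `PolynomialKoszulYoungFlatteningLeadingTerms.lean` (the triangularity device
`card_le_kyRankFin_of_leading_disjoint`), `PolynomialKoszulYoungFlatteningDuality.lean` (`kyRankFin_dual`) and
`DeterminantBorderWaringRank.lean` (`detFin`, `kyRank_detPoly_eq_kyRankFin_detFin`). Everything here is PROVED (0 sorry, no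
named facts, no cell conjecture used). HONEST FRAMING: multiplicity data and certified rank bounds at small parameters;
occurrence obstructions are ruled out in print (BIP'16) — multiplicity obstructions are the open door; nothing here is a
claim on VP vs VNP or P vs NP.

**The statement (`DetKYLeadingTermBound`, PROVED as `detKYLeadingTermBound_holds`; numbering-free form
`DetKYLeadingTerms.ltCount_le_kyRank_detPoly` over any field).** For every `n, k` and every `p ≤ n² - 1`,
```
  rank (det_n)^{∧p}_{k,n-k}  ≥  ltCount(n, n²-1-p, k) := Σ_{0 ≤ i,j < n} C(i,k)·C(j,k)·C(i·n+j, n²-1-p),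
```
the number of elements of the following explicit family `𝒟(n, c, k)` (`c = n²-1-p`) of basis tensors `∂^l ⊗ e_S` of
`S^k(K^{n²})^* ⊗ Λ^p K^{n²}`: number the matrix positions by `(i,j) ↦ i·n+j`; pick a position `(i,j)`, `k` rows `I` above `i`,
`k` columns `J` left of `j`, and `c` positions `A` before `(i,j)`; let `l` be the `k` variables `x_{π b, b}`, `b ∈ J`, for a
bijection `π : J → I`, and `S` = all positions except `(i,j)` and `A`. The image of `∂^l ⊗ e_S` under the flattening
(Landsberg 2017 (8.2.1); Guan §1.3) has `e_T`-components only for `T = S ⊔ {t}`, `t ∈ A ⊔ {(i,j)}`, and in the COLEX order on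
the `(p+1)`-sets `T` the largest of these is `T* = S ⊔ {(i,j)}` (= all positions except `A`), where the component is
`± ∂_{(i,j)} ∂^l det_n = ±` the minor of the generic matrix off the rows `I ⊔ {i}` and the columns `J ⊔ {j}` (derivatives of
`det_n` along variables in distinct rows and columns are signed complementary minors, Landsberg Exercise 6.2.2.7 — the tree's
`iterPDeriv_permSum`). Members with the same `T*` have pairwise different (rows, columns) labels, and minors with different
labels have disjoint monomial supports; so the family is block-triangular with linearly independent diagonal blocks, hence
linearly independent (Cox–Little–O'Shea Ch. 9 §3: "there is nothing to cancel the leading term"), and the rank is at least its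
size. The count is the product of the three binomials summed over `(i,j)`. With the transpose duality (tree `kyRankFin_dual`,
characteristic `0`) also `ltCount(n, p, n-1-k) ≤ rank`, whence the packaged form
`max (ltCount(n, n²-1-p, k)) (ltCount(n, p, n-1-k)) ≤ rank KY_{p,k}(det_n)` over `ℂ` (`DetKYLeadingTermBound`) — literally the hypothesis
`HypLT ∧ HypDualDet` of theory-2's kernel-checked assembly skeleton `SF6Assembly.lean` (`070a324692f9b2dc`).

**Provenance / print status.** The device and its ingredients are textbook; this particular family and its count `LT` are the
cell's (CF3-THEOREM §2); NO printed source states this bound (lit-2 presearch 2026-08-23: Landsberg 2017 §8.2 prints only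
Prop. 8.2.1.1; Farnsworth 2016 has computer ranks of `det₄`) — it is PROVED here. Sanity: `ltCount(3, ·, ·)` reproduces theory-2's
`det₃` numbers (`ltCount 3 4 1 = 361`, kernel-checked in part 2 as unnamed `example`s), and `max(LT, LT^dual) ≤` the computed ranks of
`det₃`, `det₄` at every cell (cell tables R-F-T2-18, PADDED-n4/profile_det_4).

## References (statements as printed: `HOME/typed/AS-PRINTED-2.md` §F)
* [LandsbergGCT2017] §8.2.1 eq. (8.2.1) (held PDF p. 221); Exercise 6.2.2.7 / (7.6.10).
* [Guan2016] §1.3.  * [CoxLittleOShea2007] Ch. 9 §3, proof of Prop. 4.  * [Farnsworth2016] Thm. 1.6.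
-/

noncomputable section

open MvPolynomial Finset

namespace Summit.PneNP.GCT

open Literature.Computability.AlgebraicComplexity Literature.Barriers.ValiantsHypothesis

namespace DetKYLeadingTerms

variable {K : Type*} [Field K] {n c k : ℕ}


/-- Numbering of the matrix positions: `(i, j) ↦ j + n·i`. [folklore] -/
abbrev vpos (n : ℕ) : Fin n × Fin n ≃ Fin (n * n) := finProdFinEquiv

/-- The index set `𝒟(n, c, k)` of the leading-term family: a distinguished position `(i, j)`, `k` rows above `i`,
`k` columns left of `j`, and `c` "free" positions before `(i, j)` (the positions NOT in the wedge part). [folklore] -/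
abbrev Idx (n c k : ℕ) : Type :=
  Σ rc : Fin n × Fin n,
    ↥((Iio rc.1).powersetCard k) × ↥((Iio rc.2).powersetCard k) × ↥((Iio (vpos n rc)).powersetCard c)


section Components

variable (x : Idx n c k)

/-- Distinguished row. [folklore] -/
def row : Fin n := x.1.1
/-- Distinguished column. [folklore] -/
def col : Fin n := x.1.2
/-- The `k` rows above `row`. [folklore] -/
def rowSet : Finset (Fin n) := x.2.1.1
/-- The `k` columns left of `col`. [folklore] -/
def colSet : Finset (Fin n) := x.2.2.1.1
/-- The `c` free positions before `vpos (row, col)`. [folklore] -/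
def free : Finset (Fin (n * n)) := x.2.2.2.1
/-- The distinguished position. [folklore] -/
def dpos : Fin (n * n) := vpos n x.1

/-- Unfolding `dpos`. [folklore] -/
theorem dpos_eq : dpos x = vpos n (row x, col x) := rfl

/-- `rowSet ⊆ [0, row)` and `|rowSet| = k`. [folklore] -/
theorem rowSet_spec : rowSet x ⊆ Iio (row x) ∧ (rowSet x).card = k := mem_powersetCard.1 x.2.1.2
/-- `colSet ⊆ [0, col)` and `|colSet| = k`. [folklore] -/
theorem colSet_spec : colSet x ⊆ Iio (col x) ∧ (colSet x).card = k := mem_powersetCard.1 x.2.2.1.2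
/-- `free ⊆ [0, dpos)` and `|free| = c`. [folklore] -/
theorem free_spec : free x ⊆ Iio (dpos x) ∧ (free x).card = c := mem_powersetCard.1 x.2.2.2.2

/-- `row ∉ rowSet`. [folklore] -/
theorem row_notMem_rowSet : row x ∉ rowSet x := fun h => by
  have := mem_Iio.1 ((rowSet_spec x).1 h); exact lt_irrefl _ this

/-- `col ∉ colSet`. [folklore] -/
theorem col_notMem_colSet : col x ∉ colSet x := fun h => by
  have := mem_Iio.1 ((colSet_spec x).1 h); exact lt_irrefl _ this

/-- `dpos ∉ free`. [folklore] -/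
theorem dpos_notMem_free : dpos x ∉ free x := fun h => by
  have := mem_Iio.1 ((free_spec x).1 h); exact lt_irrefl _ this


/-- A permutation carrying `colSet` onto `rowSet` and `col` to `row`. [folklore] -/
theorem exists_perm : ∃ π : Equiv.Perm (Fin n),
    π (col x) = row x ∧ (colSet x).map π.toEmbedding = rowSet x := by
  obtain ⟨π₁, hπ₁⟩ := Equiv.Perm.exists_map_finset_eq (colSet x) (rowSet x)
    ((colSet_spec x).2.trans (rowSet_spec x).2.symm)
  refine ⟨Equiv.swap (π₁ (col x)) (row x) * π₁, by simp, ?_⟩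
  rw [← hπ₁]
  ext r
  simp only [mem_map_equiv]
  constructor
  · intro h
    -- r ∈ map (swap * π₁) colSet ↔ (swap*π₁).symm r ∈ colSet
    have h' : π₁.symm (Equiv.swap (π₁ (col x)) (row x) r) ∈ colSet x := by
      simpa [Equiv.Perm.mul_def, Equiv.symm_trans_apply] using h
    have hne1 : r ≠ π₁ (col x) := by
      intro hr
      rw [hr, Equiv.swap_apply_left] at h'
      -- π₁.symm (row x) ∈ colSet ⇒ row x ∈ rowSet
      have : row x ∈ (colSet x).map π₁.toEmbedding := by
        rw [mem_map_equiv]; exact h'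
      rw [hπ₁] at this
      exact row_notMem_rowSet x this
    have hne2 : r ≠ row x := by
      intro hr
      rw [hr, Equiv.swap_apply_right, Equiv.symm_apply_apply] at h'
      exact col_notMem_colSet x h'
    rwa [Equiv.swap_apply_of_ne_of_ne hne1 hne2] at h'
  · intro h
    have hne1 : r ≠ π₁ (col x) := by
      intro hr
      rw [hr, Equiv.symm_apply_apply] at h
      exact col_notMem_colSet x h
    have hne2 : r ≠ row x := by
      intro hr
      have : row x ∈ (colSet x).map π₁.toEmbedding := by rw [mem_map_equiv, ← hr]; exact h
      rw [hπ₁] at this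
      exact row_notMem_rowSet x this
    have : π₁.symm (Equiv.swap (π₁ (col x)) (row x) r) ∈ colSet x := by
      rwa [Equiv.swap_apply_of_ne_of_ne hne1 hne2]
    simpa [Equiv.Perm.mul_def, Equiv.symm_trans_apply] using this

/-- The chosen permutation. [folklore] -/
def perm : Equiv.Perm (Fin n) := (exists_perm x).choose

/-- `perm col = row`. [folklore] -/
theorem perm_col : perm x (col x) = row x := (exists_perm x).choose_spec.1



/-- The column set of the derivative list WITH the distinguished column. [folklore] -/
def colB : Finset (Fin n) := insert (col x) (colSet x)

/-- The list of the `k` columns (any order). [folklore] -/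
def colList : List (Fin n) := (colSet x).toList

/-- The derivative list in matrix coordinates: the graph of `perm` over `colSet`. [folklore] -/
def dlist : List (Fin n × Fin n) := (colList x).map (grEmb (perm x))

/-- The derivative list in numbered coordinates. [folklore] -/
def dl : List (Fin (n * n)) := (dlist x).map (vpos n)

/-- The wedge part `S`: everything except the distinguished position and the free positions. [folklore] -/
def wS : Finset (Fin (n * n)) := (insert (dpos x) (free x))ᶜ

/-- The leading `(p+1)`-set: everything except the free positions. [folklore] -/
def lead : Finset (Fin (n * n)) := (free x)ᶜ



/-- `dpos ∉ S`. [folklore] -/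
theorem dpos_notMem_wS : dpos x ∉ wS x := by
  rw [wS, mem_compl, not_not]; exact mem_insert_self _ _

/-- The leading set is `S ⊔ {dpos}`. [folklore] -/
theorem lead_eq_insert : lead x = insert (dpos x) (wS x) := by
  ext t
  rw [lead, wS, mem_compl, mem_insert, mem_compl, mem_insert, not_or]
  constructor
  · intro ht
    by_cases h : t = dpos x
    · exact Or.inl h
    · exact Or.inr ⟨h, ht⟩
  · rintro (h | ⟨_, h⟩)
    · rw [h]; exact dpos_notMem_free x
    · exact h


end Components

/-! ### The value at the leading index -/

section Value

variable (x : Idx n c k)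

/-- The signed coefficient function of the determinant. [folklore] -/
abbrev sgnK (K : Type*) [Field K] (n : ℕ) : Equiv.Perm (Fin n) → K := fun π => ((Equiv.Perm.sign π : ℤ) : K)

/-- `col :: colList` has no duplicates. [folklore] -/
theorem nodup_cons_colList : (col x :: colList x).Nodup := by
  rw [List.nodup_cons, colList, mem_toList]
  exact ⟨col_notMem_colSet x, nodup_toList _⟩

/-- `(row, col) :: dlist` is the graph of `perm` over `col :: colList`. [folklore] -/
theorem cons_dlist_eq : (row x, col x) :: dlist x = (col x :: colList x).map (grEmb (perm x)) := by
  rw [List.map_cons, grEmb_apply, perm_col]; rfl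

/-- `∂_{(row,col)} ∂^{dlist} det_n` is the canonical derivative (signed complementary minor) — the tree's `iterPDeriv_permSum` [cite: LandsbergGCT2017, Exercise 6.2.2.7 and (7.6.10)]. -/
theorem iterPDeriv_cons_dlist_det :
    iterPDeriv ((row x, col x) :: dlist x) (detPoly (Fin n) K) = canon (sgnK K n) (perm x) (colB x) := by
  rw [detPoly_eq_permSum]
  refine iterPDeriv_permSum _ (perm x) (colB x) _ ?_ ?_
  · rw [cons_dlist_eq]
    exact (nodup_cons_colList x).map (grEmb (perm x)).injective
  · rw [cons_dlist_eq]
    ext v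
    simp only [List.mem_toFinset, List.mem_map, List.mem_cons, colList, mem_toList, colB, mem_map,
      mem_insert]

/-- **Value at the leading index**: `ε(S, v) · (± the minor of det_n off rows `rowSet ∪ {row}`, columns
`colSet ∪ {col}`)`, renamed to numbered coordinates. [folklore] -/
theorem kyImage_lead :
    kyImage (detFin K n) (dl x) (wS x) (lead x) =
      (koszulSign (wS x) (dpos x) : MvPolynomial (Fin (n * n)) K) *
        rename (vpos n) (canon (sgnK K n) (perm x) (colB x)) := by
  rw [lead_eq_insert, kyImage_apply_insert _ _ (dpos_notMem_wS x), detFin, dl,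
    iterPDeriv_rename (vpos n).injective, dpos_eq, pderiv_rename (vpos n).injective,
    ← iterPDeriv_cons, iterPDeriv_cons_dlist_det]

/-- Canonical derivatives of the determinant are nonzero (their own monomial has coefficient `sign π₀ = ±1`). [folklore] -/
theorem canon_sgn_ne_zero (π₀ : Equiv.Perm (Fin n)) (B : Finset (Fin n)) :
    canon (sgnK K n) π₀ B ≠ 0 := by
  intro h
  have hc := coeff_canon_self (sgnK K n) π₀ B
  rw [h, coeff_zero] at hc
  rcases Int.units_eq_one_or (Equiv.Perm.sign π₀) with h1 | h1 <;> simp [sgnK, h1] at hc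

/-- `ε(S, t) = ±1 ≠ 0` as a constant polynomial over a field. [folklore] -/
theorem koszulSign_cast_ne_zero {q : ℕ} (S : Finset (Fin q)) (t : Fin q) :
    (koszulSign S t : MvPolynomial (Fin q) K) ≠ 0 := by
  rw [koszulSign]
  push_cast
  exact pow_ne_zero _ (neg_ne_zero.2 one_ne_zero)

/-- The value at the leading index is nonzero. [folklore] -/
theorem kyImage_lead_ne_zero : kyImage (detFin K n) (dl x) (wS x) (lead x) ≠ 0 := by
  rw [kyImage_lead]
  exact mul_ne_zero (koszulSign_cast_ne_zero _ _)
    ((map_ne_zero_iff _ (rename_injective _ (vpos n).injective)).2 (canon_sgn_ne_zero _ _))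

end Value

end DetKYLeadingTerms

/-! ## The packaged statement of this module (PROVED) -/

/-- **Leading values of the family are nonzero**: for every member `x` of `𝒟(n, c, k)`, the `e_{T*}`-component
(`T* = lead x`) of the image of `∂^{l(x)} ⊗ e_{S(x)}` under the Koszul–Young flattening of `det_n` is
`ε · (± a minor) ≠ 0` (over `ℂ`; `DetKYLeadingTerms.kyImage_lead_ne_zero` holds over any field). A statement of the cell
(CF3-THEOREM §2, the `hdiag` part), PROVED below; not a published theorem. [folklore] -/
def DetKYLeadingValueNonzero : Prop :=
  ∀ (n c k : ℕ) (x : DetKYLeadingTerms.Idx n c k),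
    kyImage (detFin ℂ n) (DetKYLeadingTerms.dl x) (DetKYLeadingTerms.wS x) (DetKYLeadingTerms.lead x) ≠ 0

/-- `DetKYLeadingValueNonzero` holds. [folklore] -/
theorem detKYLeadingValueNonzero_holds : DetKYLeadingValueNonzero :=
  fun _ _ _ x => DetKYLeadingTerms.kyImage_lead_ne_zero x

end Summit.PneNP.GCT
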